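import Literature.Algebra.Bialgebra.DegreeTwoCupSurjectiveOfTopDegree
import HarnessLib

/-!
# Linearly independent degree-one classes have a non-zero cup product (pieces axiomatics, any characteristic)

Companion of ★ `DegreeTwoCupSurjectiveOfTopDegree`: in the PIECES axiomatics of ★ `DegreeTwoCupSurjectiveOfKunneth` (graded pieces
`HA n = Ȟⁿ(A)`, `HS n = Ȟⁿ(A × A)`, multiplicative `m^*, p₁^*, p₂^*`, Künneth injectivity), if `1 ≠ 0` in `HA 0` and the degree-one classes
`v 0, …, v (n-1)` are linearly independent, then their iterated cup product `ω n = (⋯(1 ∪ v 0) ∪ ⋯) ∪ v (n-1)` is non-zero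
(`iterCup_ne_zero_of_linearIndependent`).  This is the smallest instance of «a morphism of connected coalgebras that is injective on
primitives is injective» ([MilnorMoore1965] Prop. 3.9) for `Λ•⟨v 0, …, v (n-1)⟩ → H•`, proved directly: the bidegree-`(1, n)` Künneth
component of `m^*(ω (n+1)) = Π (p₁^*v i + p₂^*v i)` is `(-1)^n · v n ⊗ ω n` modulo `Σ_{i<n} v i ⊗ HA n` (★ `coproduct_cup_degree_one_step`);
if `ω (n+1) = 0` it vanishes, and contracting with a functional that kills `v 0, …, v (n-1)` but not `v n` gives `ω n = 0`.  It
discharges hypothesis (K3) of ★ `cup_one_one_surjective_of_topDegree` from the count `dim HA 1 ≥ N - 1` (for an abelian variety: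
`dim Ȟ¹(A, 𝒪_A) = dim A`, [GortzWedhorn2023] (27.37.2), [MumfordAV1970] §13).  Pure linear algebra; no definition, no named fact, no
`sorry`.  Cell `hodgecm-mathlib` (D-0151), P6 word «M-131» (ii), (U-ab-K) census (A-p12 (g30)); count-neutral; HC_CM is proved only modulo
the 7 printed citations until rung 0 closes, and nothing here bears on it.  ED. 2 (append-only): the COUNT FORM
`cup_one_one_surjective_of_le_finrank` (top degree `N` + `1 ≠ 0` + `N ≤ dim HA 1 + 1` ⟹ `HA 1 ⊗ HA 1 ↠ HA 2`), assembling ★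
`cup_one_one_surjective_of_topDegree` with `iterCup_ne_zero_of_linearIndependent` and Mathlib's `exists_linearIndependent_of_le_finrank`.

## References
* [MilnorMoore1965] J. W. Milnor, J. C. Moore, *On the structure of Hopf algebras*, Ann. of Math. (2) 81 (1965), §3 Prop. 3.9 (p. 225).
* [MumfordAV1970] D. Mumford, *Abelian Varieties* (1970), §13 Cor. 2 (p. 129).
* [GortzWedhorn2023] U. Görtz, T. Wedhorn, *Algebraic Geometry II: Cohomology of Schemes* (2023), (27.12) Cor. 27.79; (27.37.2).
-/

namespace Literature.Algebra.Bialgebra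

open TensorProduct Finset

universe u v w

section IterCup

variable {k : Type u} [Field k]
  {HA : ℕ → Type v} [∀ i, AddCommGroup (HA i)] [∀ i, Module k (HA i)]
  {HS : ℕ → Type w} [∀ i, AddCommGroup (HS i)] [∀ i, Module k (HS i)]
  {cupA : ∀ a b n : ℕ, a + b = n → HA a →ₗ[k] HA b →ₗ[k] HA n}
  {cupS : ∀ a b n : ℕ, a + b = n → HS a →ₗ[k] HS b →ₗ[k] HS n}
  {m p₁ p₂ : ∀ n : ℕ, HA n →ₗ[k] HS n}
  {oneA : HA 0} {oneS : HS 0}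

/-! ### The theorem -/

/-- **Linearly independent degree-one classes have non-zero cup product** (the smallest instance of «a morphism of connected coalgebras
injective on primitives is injective», [MilnorMoore1965] Prop. 3.9, for `Λ•⟨v₀,…,v_{n-1}⟩ → H`): in the pieces axiomatics, if `1 ≠ 0` in
`HA 0` and `v 0, …, v (n-1) ∈ HA 1` are linearly independent, then `ω n = (⋯(1 ∪ v 0) ∪ ⋯) ∪ v (n-1) ≠ 0`.  Induction on `n` through the
bidegree-`(1, n)` Künneth component of `m^*(ω (n+1))`, which is `(-1)^n · v n ⊗ ω n` modulo `Σ_{i<n} v i ⊗ HA n`; contract with a functional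
vanishing on `v 0, …, v (n-1)` and not on `v n`.  This discharges hypothesis (K3) of `cup_one_one_surjective_of_topDegree` from the count
`dim HA 1 ≥ N - 1`. [cite: MilnorMoore1965, §3 Prop. 3.9 (p. 225)] [cite: MumfordAV1970, §13 Cor. 2 (p. 129)] -/
theorem iterCup_ne_zero_of_linearIndependent
    (hp₁_one : p₁ 0 oneA = oneS) (hp₂_one : p₂ 0 oneA = oneS) (hm_one : m 0 oneA = oneS)
    (honeS_left : ∀ (b : ℕ) (y : HS b), cupS 0 b b (by omega) oneS y = y)
    (honeA_left : ∀ (b : ℕ) (y : HA b), cupA 0 b b (by omega) oneA y = y)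
    (hm_mul : ∀ (a b n : ℕ) (h : a + b = n) (y : HA a) (z : HA b),
      m n (cupA a b n h y z) = cupS a b n h (m a y) (m b z))
    (hp₁_mul : ∀ (a b n : ℕ) (h : a + b = n) (y : HA a) (z : HA b),
      p₁ n (cupA a b n h y z) = cupS a b n h (p₁ a y) (p₁ b z))
    (hp₂_mul : ∀ (a b n : ℕ) (h : a + b = n) (y : HA a) (z : HA b),
      p₂ n (cupA a b n h y z) = cupS a b n h (p₂ a y) (p₂ b z))
    (hassoc : ∀ (a b c ab bc n : ℕ) (hab : a + b = ab) (hbc : b + c = bc) (h : ab + c = n)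
      (y : HS a) (z : HS b) (w : HS c),
      cupS ab c n h (cupS a b ab hab y z) w = cupS a bc n (by omega) y (cupS b c bc hbc z w))
    (hcomm : ∀ (a b n : ℕ) (h : a + b = n) (y : HS a) (z : HS b),
      cupS a b n h y z = ((-1 : k) ^ (a * b)) • cupS b a n (by omega) z y)
    (hdeg1 : ∀ a : HA 1, m 1 a = p₁ 1 a + p₂ 1 a)
    (hinj : ∀ (ι : Type) (s : Finset ι) (deg : ι → ℕ × ℕ) (_ : Set.InjOn deg s) (n : ℕ)
      (t : ∀ i, HA (deg i).1 ⊗[k] HA (deg i).2),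
      (∑ i ∈ s, (if h : (deg i).1 + (deg i).2 = n then
        TensorProduct.lift ((cupS (deg i).1 (deg i).2 n h).compl₁₂ (p₁ (deg i).1) (p₂ (deg i).2)) (t i)
        else 0)) = 0 →
      ∀ i ∈ s, (deg i).1 + (deg i).2 = n → t i = 0)
    (hone : oneA ≠ 0) (v : ℕ → HA 1) (ω : ∀ j : ℕ, HA j) (hω0 : ω 0 = oneA)
    (hωs : ∀ j : ℕ, ω (j + 1) = cupA j 1 (j + 1) rfl (ω j) (v j))
    (n : ℕ) (hv : LinearIndependent k (fun i : Fin n => v (i : ℕ))) : ω n ≠ 0 := by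
  classical
  -- the invariant: the `(0, j+1)` and `(1, j)` Künneth components of `m^*(ω (j+1))`
  have inv : ∀ j : ℕ, ∃ t : ∀ p : ℕ × ℕ, HA p.1 ⊗[k] HA p.2,
      m (j + 1) (ω (j + 1)) = ∑ p ∈ antidiagonal (j + 1), (if h : p.1 + p.2 = j + 1 then
        TensorProduct.lift ((cupS p.1 p.2 (j + 1) h).compl₁₂ (p₁ p.1) (p₂ p.2)) (t p) else 0) ∧
      t (0, j + 1) = oneA ⊗ₜ ω (j + 1) ∧
      t (1, j) - ((-1 : k) ^ j) • (v j ⊗ₜ[k] ω j) ∈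
        ⨆ i : Fin j, LinearMap.range (TensorProduct.mk k (HA 1) (HA j) (v (i : ℕ))) := by
    intro j
    induction j with
    | zero =>
      set t₀ : ∀ p : ℕ × ℕ, HA p.1 ⊗[k] HA p.2 := fun p => match p with
        | (0, 0) => oneA ⊗ₜ oneA
        | _ => 0 with ht₀
      have h00 : t₀ (0, 0) = oneA ⊗ₜ oneA := rfl
      have hm0 : m 0 oneA = ∑ p ∈ antidiagonal 0, (if h : p.1 + p.2 = 0 then
          TensorProduct.lift ((cupS p.1 p.2 0 h).compl₁₂ (p₁ p.1) (p₂ p.2)) (t₀ p) else 0) := by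
        rw [Finset.Nat.antidiagonal_zero, Finset.sum_singleton]
        dsimp only
        rw [dif_pos (show 0 + 0 = 0 from rfl), h00, TensorProduct.lift.tmul, LinearMap.compl₁₂_apply, hp₁_one, hp₂_one,
          honeS_left, hm_one]
      obtain ⟨t, ht, -, h0succ, hsucc0⟩ :=
        coproduct_cup_degree_one_step hm_mul hp₁_mul hp₂_mul hassoc hcomm hdeg1 0 oneA (v 0) t₀ hm0
      refine ⟨t, ?_, ?_, ?_⟩
      · rw [hωs 0, hω0]
        exact ht
      · rw [h0succ 0, h00, TensorProduct.map_tmul, LinearMap.id_apply, LinearMap.flip_apply, hωs 0, hω0]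
      · rw [hsucc0 0, h00, TensorProduct.map_tmul, LinearMap.flip_apply, LinearMap.id_apply, honeA_left, hω0, sub_self]
        exact zero_mem _
    | succ j ih =>
      obtain ⟨t, ht, h0, h1⟩ := ih
      obtain ⟨t', ht', hstep, h0succ, -⟩ :=
        coproduct_cup_degree_one_step hm_mul hp₁_mul hp₂_mul hassoc hcomm hdeg1 (j + 1) (ω (j + 1)) (v (j + 1)) t ht
      refine ⟨t', ?_, ?_, ?_⟩
      · rw [hωs (j + 1)]
        exact ht'
      · rw [h0succ (j + 1), h0, TensorProduct.map_tmul, LinearMap.id_apply, LinearMap.flip_apply, hωs (j + 1)]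
      · have e : t' (1, j + 1) =
            ((-1 : k) ^ (j + 1)) • TensorProduct.map ((cupA 0 1 1 rfl).flip (v (j + 1))) LinearMap.id (t (0, j + 1)) +
              TensorProduct.map LinearMap.id ((cupA j 1 (j + 1) rfl).flip (v (j + 1))) (t (1, j)) := hstep 0 j
        rw [e, h0, TensorProduct.map_tmul, LinearMap.flip_apply, LinearMap.id_apply, honeA_left, add_sub_cancel_left]
        -- `(id ⊗ (· ∪ v (j+1)))` maps `Σ_{i<j} v i ⊗ HA j` and `v j ⊗ HA j` into `Σ_{i<j+1} v i ⊗ HA (j+1)`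
        have hle : (⨆ i : Fin j, LinearMap.range (TensorProduct.mk k (HA 1) (HA j) (v (i : ℕ)))) ≤
            Submodule.comap (TensorProduct.map LinearMap.id ((cupA j 1 (j + 1) rfl).flip (v (j + 1))))
              (⨆ i : Fin (j + 1), LinearMap.range (TensorProduct.mk k (HA 1) (HA (j + 1)) (v (i : ℕ)))) := by
          refine iSup_le fun i => ?_
          rintro _ ⟨w, rfl⟩
          rw [Submodule.mem_comap, TensorProduct.mk_apply, TensorProduct.map_tmul, LinearMap.id_apply, LinearMap.flip_apply]
          exact Submodule.mem_iSup_of_mem (Fin.castSucc i) ⟨cupA j 1 (j + 1) rfl w (v (j + 1)), rfl⟩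
        have hsplit : t (1, j) = (t (1, j) - ((-1 : k) ^ j) • (v j ⊗ₜ[k] ω j)) + ((-1 : k) ^ j) • (v j ⊗ₜ[k] ω j) :=
          (sub_add_cancel _ _).symm
        rw [hsplit, map_add, map_smul, TensorProduct.map_tmul, LinearMap.id_apply, LinearMap.flip_apply]
        refine add_mem (hle h1) (Submodule.smul_mem _ _ ?_)
        refine Submodule.mem_iSup_of_mem (Fin.last j) ⟨cupA j 1 (j + 1) rfl (ω j) (v (j + 1)), ?_⟩
        rw [TensorProduct.mk_apply, Fin.val_last]
  -- induction on `n`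
  induction n with
  | zero =>
    rw [hω0]
    exact hone
  | succ n ih =>
    intro h0
    have hv' : LinearIndependent k (fun i : Fin n => v (i : ℕ)) := hv.comp Fin.castSucc (Fin.castSucc_injective n)
    have hωn : ω n ≠ 0 := ih hv'
    obtain ⟨t, ht, -, h1⟩ := inv n
    rw [h0, map_zero] at ht
    have ht1 : t (1, n) = 0 :=
      hinj (ℕ × ℕ) (antidiagonal (n + 1)) (fun i => i) (Set.injOn_of_injective Function.injective_id) (n + 1) t ht.symm
        (1, n) (mem_antidiagonal.mpr (by omega)) (by show 1 + n = n + 1; omega)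
    rw [ht1, zero_sub] at h1
    -- `v n ⊗ ω n ∈ Σ_{i<n} v i ⊗ HA n`
    have hmem : v n ⊗ₜ[k] ω n ∈ ⨆ i : Fin n, LinearMap.range (TensorProduct.mk k (HA 1) (HA n) (v (i : ℕ))) := by
      have h2 := Submodule.smul_mem _ ((-1 : k) ^ n) (Submodule.neg_mem _ h1)
      rwa [neg_neg, smul_smul, ← pow_add, ← two_mul, pow_mul, neg_one_sq, one_pow, one_smul] at h2
    -- a functional vanishing on `v 0, …, v (n-1)` and not on `v n`
    have hx : v n ∉ Submodule.span k (Set.range fun i : Fin n => v (i : ℕ)) := by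
      intro hmem'
      have hsub : Set.range (fun i : Fin n => v (i : ℕ)) ⊆ (fun i : Fin (n + 1) => v (i : ℕ)) '' {Fin.last n}ᶜ := by
        rintro _ ⟨i, rfl⟩
        exact ⟨Fin.castSucc i, Set.mem_compl_singleton_iff.mpr (Fin.castSucc_lt_last i).ne, rfl⟩
      have hlast := hv.notMem_span (Fin.last n)
      simp only [Fin.val_last] at hlast
      exact hlast (Submodule.span_mono hsub hmem')
    obtain ⟨f, hf, hfbot⟩ := Submodule.exists_dual_map_eq_bot_of_notMem hx inferInstance
    have hfi : ∀ i : Fin n, f (v (i : ℕ)) = 0 := fun i => by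
      have hm : f (v (i : ℕ)) ∈ (Submodule.span k (Set.range fun i : Fin n => v (i : ℕ))).map f :=
        Submodule.mem_map_of_mem (Submodule.subset_span ⟨i, rfl⟩)
      rw [hfbot] at hm
      exact (Submodule.mem_bot k).mp hm
    -- contract with `f ⊗ id`
    have hΦ : ∀ r ∈ ⨆ i : Fin n, LinearMap.range (TensorProduct.mk k (HA 1) (HA n) (v (i : ℕ))),
        (TensorProduct.lid k (HA n)) (LinearMap.rTensor (HA n) f r) = 0 := by
      intro r hr
      refine Submodule.iSup_induction (fun i : Fin n => LinearMap.range (TensorProduct.mk k (HA 1) (HA n) (v (i : ℕ))))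
        (motive := fun r => (TensorProduct.lid k (HA n)) (LinearMap.rTensor (HA n) f r) = 0) hr ?_ ?_ ?_
      · rintro i _ ⟨w, rfl⟩
        rw [TensorProduct.mk_apply, LinearMap.rTensor_tmul, TensorProduct.lid_tmul, hfi i, zero_smul]
      · rw [map_zero, map_zero]
      · intro a b ha hb
        rw [map_add, map_add, ha, hb, add_zero]
    have hcontr := hΦ _ hmem
    rw [LinearMap.rTensor_tmul, TensorProduct.lid_tmul] at hcontr
    exact hωn ((smul_eq_zero.mp hcontr).resolve_left hf)

end IterCup

section CountForm

variable {k : Type u} [Field k]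
  {HA : ℕ → Type v} [∀ i, AddCommGroup (HA i)] [∀ i, Module k (HA i)]
  {HS : ℕ → Type w} [∀ i, AddCommGroup (HS i)] [∀ i, Module k (HS i)]
  {cupA : ∀ a b n : ℕ, a + b = n → HA a →ₗ[k] HA b →ₗ[k] HA n}
  {cupS : ∀ a b n : ℕ, a + b = n → HS a →ₗ[k] HS b →ₗ[k] HS n}
  {m p₁ p₂ : ∀ n : ℕ, HA n →ₗ[k] HS n} {i₁ i₂ : ∀ n : ℕ, HS n →ₗ[k] HA n}
  {oneA : HA 0} {oneS : HS 0} {aug : HA 0 →ₗ[k] k}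

/-! ### ED. 2 — the count form: `H¹ ∪ H¹ = H²` from the top degree and `dim HA 1 ≥ N - 1` -/

/-- **`H¹ ∪ H¹ = H²` from the top degree and the `H¹`-count (any characteristic).**  In the pieces axiomatics of ★
`cup_one_one_surjective` — WITHOUT `CharZero k` — suppose `HA n = 0` for `n > N`, `1 ≠ 0` in `HA 0`, and `N ≤ dim_k HA 1 + 1`.  Then the
cup product `HA 1 ⊗ HA 1 → HA 2` is onto: choose `N - 1` linearly independent degree-one classes (`exists_linearIndependent_of_le_finrank`),
their iterated product is non-zero (★ `iterCup_ne_zero_of_linearIndependent`), and ★ `cup_one_one_surjective_of_topDegree` applies.  For an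
abelian variety of dimension `g` over any field on an affine cover with `g + 1` members: `N = g` and `dim Ȟ¹(A, 𝒪_A) = g`.
[cite: GortzWedhorn2023, Cor. 27.79] [cite: GortzWedhorn2023, Cor. 27.200] [cite: MumfordAV1970, §13 Cor. 2 (p. 129)] -/
theorem cup_one_one_surjective_of_le_finrank
    (haug : ∀ z : HA 0, z = aug z • oneA) (hp₁_one : p₁ 0 oneA = oneS) (hp₂_one : p₂ 0 oneA = oneS)
    (hm_one : m 0 oneA = oneS)
    (honeS_left : ∀ (b : ℕ) (y : HS b), cupS 0 b b (by omega) oneS y = y)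
    (honeS_right : ∀ (a : ℕ) (y : HS a), cupS a 0 a (by omega) y oneS = y)
    (honeA_left : ∀ (b : ℕ) (y : HA b), cupA 0 b b (by omega) oneA y = y)
    (hm_mul : ∀ (a b n : ℕ) (h : a + b = n) (y : HA a) (z : HA b),
      m n (cupA a b n h y z) = cupS a b n h (m a y) (m b z))
    (hp₁_mul : ∀ (a b n : ℕ) (h : a + b = n) (y : HA a) (z : HA b),
      p₁ n (cupA a b n h y z) = cupS a b n h (p₁ a y) (p₁ b z))
    (hp₂_mul : ∀ (a b n : ℕ) (h : a + b = n) (y : HA a) (z : HA b),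
      p₂ n (cupA a b n h y z) = cupS a b n h (p₂ a y) (p₂ b z))
    (hi₁_mul : ∀ (a b n : ℕ) (h : a + b = n) (Y : HS a) (Z : HS b),
      i₁ n (cupS a b n h Y Z) = cupA a b n h (i₁ a Y) (i₁ b Z))
    (hi₂_mul : ∀ (a b n : ℕ) (h : a + b = n) (Y : HS a) (Z : HS b),
      i₂ n (cupS a b n h Y Z) = cupA a b n h (i₂ a Y) (i₂ b Z))
    (hi₁m : ∀ (n : ℕ) (y : HA n), i₁ n (m n y) = y) (hi₂m : ∀ (n : ℕ) (y : HA n), i₂ n (m n y) = y)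
    (hi₁p₁ : ∀ (n : ℕ) (y : HA n), i₁ n (p₁ n y) = y) (hi₂p₂ : ∀ (n : ℕ) (y : HA n), i₂ n (p₂ n y) = y)
    (hi₁p₂ : ∀ (n : ℕ), 1 ≤ n → ∀ (y : HA n), i₁ n (p₂ n y) = 0)
    (hi₂p₁ : ∀ (n : ℕ), 1 ≤ n → ∀ (y : HA n), i₂ n (p₁ n y) = 0)
    (hassoc : ∀ (a b c ab bc n : ℕ) (hab : a + b = ab) (hbc : b + c = bc) (h : ab + c = n)
      (y : HS a) (z : HS b) (w : HS c),
      cupS ab c n h (cupS a b ab hab y z) w = cupS a bc n (by omega) y (cupS b c bc hbc z w))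
    (hcomm : ∀ (a b n : ℕ) (h : a + b = n) (y : HS a) (z : HS b),
      cupS a b n h y z = ((-1 : k) ^ (a * b)) • cupS b a n (by omega) z y)
    (hinj : ∀ (ι : Type) (s : Finset ι) (deg : ι → ℕ × ℕ) (_ : Set.InjOn deg s) (n : ℕ)
      (t : ∀ i, HA (deg i).1 ⊗[k] HA (deg i).2),
      (∑ i ∈ s, (if h : (deg i).1 + (deg i).2 = n then
        TensorProduct.lift ((cupS (deg i).1 (deg i).2 n h).compl₁₂ (p₁ (deg i).1) (p₂ (deg i).2)) (t i)
        else 0)) = 0 →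
      ∀ i ∈ s, (deg i).1 + (deg i).2 = n → t i = 0)
    (hsurj : ∀ (n : ℕ) (z : HS n), ∃ t : ∀ p : ℕ × ℕ, HA p.1 ⊗[k] HA p.2,
      z = ∑ p ∈ antidiagonal n, (if h : p.1 + p.2 = n then
        TensorProduct.lift ((cupS p.1 p.2 n h).compl₁₂ (p₁ p.1) (p₂ p.2)) (t p) else 0))
    (hone : oneA ≠ 0) (N : ℕ) (hN : ∀ n : ℕ, N < n → ∀ y : HA n, y = 0)
    (hdim : N ≤ Module.finrank k (HA 1) + 1) :
    Function.Surjective (TensorProduct.lift (cupA 1 1 2 rfl)) := by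
  classical
  -- `N - 1` linearly independent degree-one classes, padded by `0`
  obtain ⟨u, hu⟩ := exists_linearIndependent_of_le_finrank (R := k) (M := HA 1) (n := N - 1) (by omega)
  let v : ℕ → HA 1 := fun i => if h : i < N - 1 then u ⟨i, h⟩ else 0
  let ω : ∀ j : ℕ, HA j := fun j => Nat.rec (motive := fun j => HA j) oneA (fun j w => cupA j 1 (j + 1) rfl w (v j)) j
  have hω0 : ω 0 = oneA := rfl
  have hωs : ∀ j : ℕ, ω (j + 1) = cupA j 1 (j + 1) rfl (ω j) (v j) := fun j => rfl
  have hv : LinearIndependent k (fun i : Fin (N - 1) => v (i : ℕ)) := by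
    have e : (fun i : Fin (N - 1) => v (i : ℕ)) = u := funext fun i => by
      show (if h : (i : ℕ) < N - 1 then u ⟨i, h⟩ else 0) = u i
      rw [dif_pos i.2]
    rw [e]
    exact hu
  have hdeg1 : ∀ a : HA 1, m 1 a = p₁ 1 a + p₂ 1 a :=
    coproduct_degree_one haug hp₁_one hp₂_one honeS_left honeS_right hi₁m hi₂m hi₁p₁ hi₂p₂ hi₁p₂ hi₂p₁ hsurj
  have hω : ω (N - 1) ≠ 0 :=
    iterCup_ne_zero_of_linearIndependent hp₁_one hp₂_one hm_one honeS_left honeA_left hm_mul hp₁_mul hp₂_mul hassoc hcomm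
      hdeg1 hinj hone v ω hω0 hωs (N - 1) hv
  exact cup_one_one_surjective_of_topDegree haug hp₁_one hp₂_one honeS_left honeS_right hm_mul hp₁_mul hp₂_mul hi₁_mul hi₂_mul
    hi₁m hi₂m hi₁p₁ hi₂p₂ hi₁p₂ hi₂p₁ hassoc hcomm hinj hsurj N hN v ω hω0 hωs hω

end CountForm

end Literature.Algebra.Bialgebra
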